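/-
COR-CM (cell pub-hodgecm2, stage 2 of the Hodge ladder) — Δ2 BRIDGE, ORIENTATION AUDIT, TEST T1 — KEY-GENERIC forms and the MIRROR under the
conjugate key, for the (c-S.1) RE-KEY of the dictionary at `ῑ₁` (coordinator verdict 2026-08-23T21:3xZ); wall-breaker seat wb-6
(prover-pub-hodgecm2-d2bridge-wb-6-g0-0).  Sibling of ✔ `OrientationT1CmClassesHodgeType.lean` (edition 1, p372128), which it imports together
with own-crow g93's ✔ `OrientationReflexConj.lean` (orientation lemmas BY NAME).  THEOREMS ONLY; nothing landed is edited or restated; no named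
fact, no `sorry`, explicit per-theorem binders.  FRAMING: HC_CM is NOT proved; «Δ2 BRIDGE CLOSED» is NOT claimed.
-/
import Summits.HodgeConjecture.CorCM.D2Bridge.OrientationT1CmClassesHodgeType
import Summits.HodgeConjecture.CorCM.D2Bridge.OrientationReflexConj
import HarnessLib

/-!
# Δ2 bridge, orientation audit T1 — key-generic forms and the conjugate-key mirror

Edition 1 (`OrientationT1CmClassesHodgeType.lean`) reads Liu's side condition at the embedding `ι₁` of `V : HermSpace3 L ι₁`.  Its proof
only uses `d.τ ∈ d.ΦA`; so, over the SAME surfaces `P_Γ = U.pms L ι₁ V Γ` and for ANY real-carrier dictionary `T` over `V`: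

* `map_span_cmClasses_le_hodgeOneZero_of_tau_mem` / `map_span_cmClasses_le_hodgeZeroOne_of_tau_notMem` — KEY-FREE: if every record
  admissible for `μ` has `d.τ ∈ d.ΦA` (resp. `d.τ ∉ d.ΦA`) then `β (span_ℂ (T.cmClasses Γ μ)) ≤ H^{1,0}(P_Γ)` (resp. `≤ H^{0,1}(P_Γ)`).
* `map_span_cmClasses_le_hodgeOneZero_of_key (κ)` / `…_of_keyG (κ)` — admissibility read through ANY embedding `κ : L → ℂ` with `κ ∈ Φ`
  (`d.IsReflexOfType κ Φ`, resp. the Galois-guarded `IsReflexOfTypeG`) gives HOLOMORPHIC generators.  At `κ := ῑ₁` this is T1 for the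
  dictionary RE-KEYED at the uniformising embedding (ORIENTATION-MEMO v1.3 §5 (W1); `adm′ i d := d.IsReflexOfTypeG ῑ₁ (typeOfLine (line i))`,
  `PhiMu′ i := ῑ₁ ∈ Φ`): a one-liner, whatever the re-keyed dictionary's other fields are.
* `map_span_cmClasses_le_hodgeZeroOne_of_conjKey (κ)` / `…_of_conjKeyG (κ)` — THE MIRROR (`L/ℚ` Galois): admissibility read through the
  CONJUGATE embedding `conj ∘ κ` for a type `Φ ∋ κ` gives ANTI-HOLOMORPHIC generators (own-crow's
  `tau_notMem_cmType_of_isReflexOfType_starRingEnd_comp`).  At `κ := ι₁`: the dictionary re-keyed at `ῑ₁`, read at a line with the ORIGINAL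
  `PhiMu` (`ι₁ ∈ Φ`, i.e. `ῑ₁ ∉ Φ`), generates `(0,1)`-classes — the Hodge type of Liu's placement at `τ' = ῑ₁ ∉ Φ_μ`.

References: [Liu2021] Y. Liu, arXiv:2102.11518, Def. 4.3 (TeX ll. 1914–1921), Rem. 4.4 (ll. 1930–1933); [Shimura1998] §5.2 pp. 36–37,
§8.3 Prop. 28; [VoisinHodgeI2002] §7.1.1, §7.3.2.
-/

set_option autoImplicit false

noncomputable section

namespace Summit.HodgeConjecture.CorCM.D2Bridge

open scoped TensorProduct
open NumberField CategoryTheory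
open Literature.AlgebraicGeometry.Motives (CMType IsSmoothProjective bettiCohomology)
open Literature.AlgebraicGeometry.HodgeTheory
open Literature.NumberTheory.Automorphic.PicardCM
open HodgeCM HodgeCM.Model

namespace LiuDictionaryHodge

variable {hHD : exists_isReal_hodgeModel} {hI : hodgePQ_independent_of_hodgeModel}
  {h₁ : BallQuotientUniformised} {h₃ : CMAbelianVarietyRealised}
  {L : CMField} {ι₁ : L →+* ℂ} {V : HermSpace3 L ι₁}

/-- **Key-free form**: if every record admissible for `μ` has its eigencharacter in its CM type (`d.τ ∈ d.ΦA`), then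
`β (span_ℂ (T.cmClasses Γ μ)) ≤ H^{1,0}(P_Γ)`. [cite: Shimura1998, §5.2 (pp. 36–37)] [cite: VoisinHodgeI2002, §7.1.1 and §7.3.2] -/
theorem map_span_cmClasses_le_hodgeOneZero_of_tau_mem (T : LiuDictionary hHD hI h₁ h₃ V) (Γ : Level V) (μ : T.Char)
    (hadm : ∀ d : LiuCMSide, T.adm μ d → d.τ ∈ d.ΦA.1) :
    (Submodule.span ℂ (T.cmClasses Γ μ)).map
        (ofRatClassBaseChangeEquiv (isSmoothProjective_pmsScheme (h₁ := h₁) Γ) 1).toLinearMap ≤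
      hodgeOneZero (isSmoothProjective_pmsScheme (h₁ := h₁) Γ) := by
  refine Submodule.map_le_iff_le_comap.2 (Submodule.span_le.2 fun x hx => ?_)
  simp only [LiuDictionary.cmClasses, Set.mem_iUnion, Set.mem_range] at hx
  obtain ⟨d, hd, f, rfl⟩ := hx
  exact isOfHodgeType_oneZero_geomClass Γ d (hadm d hd) f

/-- **Key-free (0,1) twin**: if every record admissible for `μ` has its eigencharacter OUTSIDE its CM type (`d.τ ∉ d.ΦA`), then
`β (span_ℂ (T.cmClasses Γ μ)) ≤ H^{0,1}(P_Γ)`. [cite: Shimura1998, §5.2 (pp. 36–37)] [cite: VoisinHodgeI2002, §7.1.1 and §7.3.2] -/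
theorem map_span_cmClasses_le_hodgeZeroOne_of_tau_notMem (T : LiuDictionary hHD hI h₁ h₃ V) (Γ : Level V) (μ : T.Char)
    (hadm : ∀ d : LiuCMSide, T.adm μ d → d.τ ∉ d.ΦA.1) :
    (Submodule.span ℂ (T.cmClasses Γ μ)).map
        (ofRatClassBaseChangeEquiv (isSmoothProjective_pmsScheme (h₁ := h₁) Γ) 1).toLinearMap ≤
      hodgeZeroOne (isSmoothProjective_pmsScheme (h₁ := h₁) Γ) := by
  refine Submodule.map_le_iff_le_comap.2 (Submodule.span_le.2 fun x hx => ?_)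
  simp only [LiuDictionary.cmClasses, Set.mem_iUnion, Set.mem_range] at hx
  obtain ⟨d, hd, f, rfl⟩ := hx
  exact isOfHodgeType_zeroOne_geomClass Γ d (hadm d hd) f

/-- **Key-generic T1**: for ANY embedding `κ : L → ℂ` with `κ ∈ Φ`, if every record admissible for `μ` is the reflex side of `Φ` through
`κ` (`d.IsReflexOfType κ Φ`), then `β (span_ℂ (T.cmClasses Γ μ)) ≤ H^{1,0}(P_Γ)` — the surfaces `P_Γ = U.pms L ι₁ V Γ` are those of `V`'s
own key `ι₁`, whatever `κ` is.  At `κ := ῑ₁` this is T1 for the dictionary RE-KEYED at the uniformising embedding.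
[cite: Liu2021, Definition 4.3 (TeX ll. 1914–1921)] [cite: VoisinHodgeI2002, §7.1.1 and §7.3.2] -/
theorem map_span_cmClasses_le_hodgeOneZero_of_key (T : LiuDictionary hHD hI h₁ h₃ V) (Γ : Level V) (μ : T.Char)
    (κ : L →+* ℂ) (Φ : CMType L) (hadm : ∀ d : LiuCMSide, T.adm μ d → d.IsReflexOfType κ Φ) (hΦ : κ ∈ Φ.1) :
    (Submodule.span ℂ (T.cmClasses Γ μ)).map
        (ofRatClassBaseChangeEquiv (isSmoothProjective_pmsScheme (h₁ := h₁) Γ) 1).toLinearMap ≤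
      hodgeOneZero (isSmoothProjective_pmsScheme (h₁ := h₁) Γ) :=
  map_span_cmClasses_le_hodgeOneZero_of_tau_mem T Γ μ fun d hd => tau_mem_cmType_of_isReflexOfType κ d Φ (hadm d hd) hΦ

/-- Key-generic T1, Galois-guarded admissibility (the literal shape of a re-keyed `adm′ μ d := d.IsReflexOfTypeG κ Φ_μ`), `L/ℚ` Galois.
[cite: Liu2021, Definition 4.3 (TeX ll. 1914–1921)] [cite: VoisinHodgeI2002, §7.1.1 and §7.3.2] -/
theorem map_span_cmClasses_le_hodgeOneZero_of_keyG [IsGalois ℚ L] (T : LiuDictionary hHD hI h₁ h₃ V) (Γ : Level V) (μ : T.Char)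
    (κ : L →+* ℂ) (Φ : CMType L) (hadm : ∀ d : LiuCMSide, T.adm μ d → d.IsReflexOfTypeG κ Φ) (hΦ : κ ∈ Φ.1) :
    (Submodule.span ℂ (T.cmClasses Γ μ)).map
        (ofRatClassBaseChangeEquiv (isSmoothProjective_pmsScheme (h₁ := h₁) Γ) 1).toLinearMap ≤
      hodgeOneZero (isSmoothProjective_pmsScheme (h₁ := h₁) Γ) :=
  map_span_cmClasses_le_hodgeOneZero_of_key T Γ μ κ Φ (fun d hd => hadm d hd inferInstance) hΦ

/-- **MIRROR under the conjugate key** (`L/ℚ` Galois): if every record admissible for `μ` is the reflex side of `Φ` through the CONJUGATE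
embedding `conj ∘ κ` while `κ ∈ Φ`, then the generators are ANTI-holomorphic: `β (span_ℂ (T.cmClasses Γ μ)) ≤ H^{0,1}(P_Γ)`
(own-crow's `tau_notMem_cmType_of_isReflexOfType_starRingEnd_comp`: `conj ∘ κ`-admissibility for `Φ ∋ κ` puts `d.τ` OUTSIDE `d.ΦA`).  At
`κ := ι₁` this is the dictionary RE-KEYED at `ῑ₁` read at a line with the ORIGINAL `PhiMu` (`ι₁ ∈ Φ`, i.e. `ῑ₁ ∉ Φ`).
[cite: Liu2021, Remark 4.4 (TeX ll. 1930–1933)] [cite: Shimura1998, §8.3 Prop. 28] [cite: VoisinHodgeI2002, §7.1.1 and §7.3.2] -/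
theorem map_span_cmClasses_le_hodgeZeroOne_of_conjKey [IsGalois ℚ L] (T : LiuDictionary hHD hI h₁ h₃ V) (Γ : Level V) (μ : T.Char)
    (κ : L →+* ℂ) (Φ : CMType L) (hadm : ∀ d : LiuCMSide, T.adm μ d → d.IsReflexOfType ((starRingEnd ℂ).comp κ) Φ) (hΦ : κ ∈ Φ.1) :
    (Submodule.span ℂ (T.cmClasses Γ μ)).map
        (ofRatClassBaseChangeEquiv (isSmoothProjective_pmsScheme (h₁ := h₁) Γ) 1).toLinearMap ≤
      hodgeZeroOne (isSmoothProjective_pmsScheme (h₁ := h₁) Γ) :=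
  map_span_cmClasses_le_hodgeZeroOne_of_tau_notMem T Γ μ fun d hd =>
    tau_notMem_cmType_of_isReflexOfType_starRingEnd_comp κ d Φ (hadm d hd) hΦ

/-- The same with Galois-guarded admissibility (`adm′ μ d := d.IsReflexOfTypeG ῑ₁ Φ`, the literal shape of a re-keyed dictionary).
[cite: Liu2021, Remark 4.4 (TeX ll. 1930–1933)] [cite: VoisinHodgeI2002, §7.1.1 and §7.3.2] -/
theorem map_span_cmClasses_le_hodgeZeroOne_of_conjKeyG [IsGalois ℚ L] (T : LiuDictionary hHD hI h₁ h₃ V) (Γ : Level V) (μ : T.Char)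
    (κ : L →+* ℂ) (Φ : CMType L) (hadm : ∀ d : LiuCMSide, T.adm μ d → d.IsReflexOfTypeG ((starRingEnd ℂ).comp κ) Φ) (hΦ : κ ∈ Φ.1) :
    (Submodule.span ℂ (T.cmClasses Γ μ)).map
        (ofRatClassBaseChangeEquiv (isSmoothProjective_pmsScheme (h₁ := h₁) Γ) 1).toLinearMap ≤
      hodgeZeroOne (isSmoothProjective_pmsScheme (h₁ := h₁) Γ) :=
  map_span_cmClasses_le_hodgeZeroOne_of_conjKey T Γ μ κ Φ (fun d hd => hadm d hd inferInstance) hΦ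

end LiuDictionaryHodge

/-! ## At the pinned dictionary: the mirror read at the ORIGINAL pin through the conjugate key is NOT the pin's own `adm`
(that is keyed at `ι₁`); what the pin gives at a `PhiMu` line is edition 1's `map_span_cmClasses_liuDictionaryPin_le_hodgeOneZero`.
The re-keyed dictionary (`CorCM/Rekey/**`, to land) instantiates `map_span_cmClasses_le_hodgeOneZero_of_keyG` at `κ := ῑ₁` and
`map_span_cmClasses_le_hodgeZeroOne_of_conjKeyG` at `κ := ι₁` by `rfl` on its `adm′`. -/

end Summit.HodgeConjecture.CorCM.D2Bridge

end
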